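import Literature.NumberTheory.EllipticCurves.FormalExpTaylorUniformizationProofs
import Literature.NumberTheory.EllipticCurves.FormalGroupNegOmegaProofs
import Literature.NumberTheory.EllipticCurves.FormalGroupDictionaryProofs
import Summits.BirchSwinnertonDyer.BirchSwinnertonDyer.Theorems.EisensteinDepletionAtTwoStarOptBNSFParamExpansion
import HarnessLib

/-!
# The analytic dictionary `x·t² = X(t)` along the uniformisation (line `nsf` v18, helper for stub S3-Q, crux `StarOptBNSF`, stmt-BirchSwinnertonDyer-27047)

For a Weierstrass model `W/ℂ` and a Néron period pair `L` (`g₂ = c₄/12`, `g₃ = c₆/216`), let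
`x = ℘_L − b₂/12`, `y = (℘_L′ − a₁x − a₃)/2`, `t = −x/y` (the local parameter, extended by `0` on `Λ`).  The function
`ξ(z) := x(z)·t(z)²` (extended by `1` on `Λ`) is analytic at `0` and **its Taylor series at `0` is `X ∘ exp_W`**, where
`X = formalXMulSq = z²x(z) ∈ ℂ⟦z⟧` is the formal Laurent dictionary of AEC IV.1 and `exp_W` the formal exponential
(`taylor_xMulLocalParamSq`): the analytic function `x·t²` IS the formal series `X` read in the parameter `t`, whose Taylor
series is `exp_W` (tree `taylor_localParam_eq_formalExp`).  Proof: with `𝔴 = −1/y`, `ξ·𝔴 = t³` near `0`; the Taylor series of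
`𝔴` is the fixed point `w(𝓣[t])` of AEC IV.1.1 (tree `fixedPoint_unique`, the same identity (E1) as in the tree's proof of
`taylor_localParam_eq_formalExp`); and `X·w = z³` formally (`formalXMulSq_mul_formalW`).
BSD is not proved by this file; nothing here reads `r_an`.
-/

set_option linter.dupNamespace false
set_option autoImplicit false

noncomputable section

open PowerSeries Filter Set Literature.NumberTheory.Transcendental.AndreCriterion
open scoped Topology Nat Classical PeriodPair

/-- The Taylor series of `f : ℂ → ℂ` at `0` (local notation, as in `AndreCriterionAnalyticProofs`). -/
local notation3 "𝓣[" f "]" =>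
  (PowerSeries.mk fun n => ((Nat.factorial n : ℂ)⁻¹ * iteratedDeriv n f 0) : PowerSeries ℂ)

namespace Summit.BirchSwinnertonDyer.BirchSwinnertonDyer.Theorems.DepletionAtTwo.KummerQExp

open Literature.NumberTheory.EllipticCurves WeierstrassCurve

variable (L : PeriodPair) (W : WeierstrassCurve ℂ)

/-- **The Taylor series of `𝔴 = −1/y` along the uniformisation is `w(exp_W)`**, the fixed point of AEC IV.1.1 read in the
formal exponential. (The identity (E1) of the tree's `taylor_localParam_eq_formalExp`, adapted from
`Literature/NumberTheory/EllipticCurves/FormalExpTaylorUniformizationProofs.lean`, plus `fixedPoint_unique`.)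
[cite: SilvermanAEC2009, IV.1.1] [folklore] -/
theorem taylor_localParamW_eq (h₂ : L.g₂ = W.c₄ / 12) (h₃ : L.g₃ = W.c₆ / 216) :
    𝓣[(fun z => if z ∈ L.lattice then (0 : ℂ) else
        -1 / ((℘'[L] z - W.a₁ * (℘[L] z - W.b₂ / 12) - W.a₃) / 2))] =
      W.formalW.subst W.formalExp := by
  obtain ⟨hta, hwa⟩ := analyticAt_localParam L W
  have hexp := taylor_localParam_eq_formalExp L W h₂ h₃
  have hy := eventually_y_ne_zero L W
  set x : ℂ → ℂ := fun z => ℘[L] z - W.b₂ / 12 with hx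
  set y : ℂ → ℂ := fun z => (℘'[L] z - W.a₁ * (℘[L] z - W.b₂ / 12) - W.a₃) / 2 with hydef
  set t : ℂ → ℂ := fun z => if z ∈ L.lattice then (0 : ℂ) else
    -(℘[L] z - W.b₂ / 12) / ((℘'[L] z - W.a₁ * (℘[L] z - W.b₂ / 12) - W.a₃) / 2) with ht
  set w : ℂ → ℂ := fun z => if z ∈ L.lattice then (0 : ℂ) else
    -1 / ((℘'[L] z - W.a₁ * (℘[L] z - W.b₂ / 12) - W.a₃) / 2) with hw
  have ht0 : t 0 = 0 := by rw [ht]; exact if_pos (zero_mem _)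
  have hw0 : w 0 = 0 := by rw [hw]; exact if_pos (zero_mem _)
  have hΛ := L.eventually_nhdsNE_notMem_lattice
  have htz : ∀ z, z ∉ L.lattice → t z = -x z / y z := fun z hz => by rw [ht]; exact if_neg hz
  have hwz : ∀ z, z ∉ L.lattice → w z = -1 / y z := fun z hz => by rw [hw]; exact if_neg hz
  -- (E1): the Weierstrass equation divided by `y³`
  have hE1 : w =ᶠ[𝓝 0] fun z => t z ^ 3 + W.a₁ * (t * w) z + W.a₂ * (t ^ 2 * w) z +
      W.a₃ * (w ^ 2) z + W.a₄ * (t * w ^ 2) z + W.a₆ * (w ^ 3) z := by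
    refine eventually_nhds_of_nhdsNE ?_ (by simp [ht0, hw0])
    filter_upwards [hΛ, hy] with z hzΛ hyz
    simp only [Pi.mul_apply, Pi.pow_apply]
    rw [htz z hzΛ, hwz z hzΛ]
    have heq := equation_weierstrassP_sub L W h₂ h₃ hzΛ
    change y z ^ 2 + W.a₁ * x z * y z + W.a₃ * y z = x z ^ 3 + W.a₂ * x z ^ 2 + W.a₄ * x z + W.a₆
      at heq
    have key : -1 / y z - ((-x z / y z) ^ 3 + W.a₁ * (-x z / y z * (-1 / y z)) +
        W.a₂ * ((-x z / y z) ^ 2 * (-1 / y z)) + W.a₃ * (-1 / y z) ^ 2 +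
        W.a₄ * (-x z / y z * (-1 / y z) ^ 2) + W.a₆ * (-1 / y z) ^ 3) =
        (-1 / y z ^ 3) * ((y z ^ 2 + W.a₁ * x z * y z + W.a₃ * y z) -
          (x z ^ 3 + W.a₂ * x z ^ 2 + W.a₄ * x z + W.a₆)) := by
      field_simp
      ring
    rw [heq, sub_self, mul_zero, sub_eq_zero] at key
    exact key
  have hfun1 : (fun z => t z ^ 3 + W.a₁ * (t * w) z + W.a₂ * (t ^ 2 * w) z +
      W.a₃ * (w ^ 2) z + W.a₄ * (t * w ^ 2) z + W.a₆ * (w ^ 3) z) =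
      t ^ 3 + (fun z => W.a₁ * (t * w) z) + (fun z => W.a₂ * (t ^ 2 * w) z) +
        (fun z => W.a₃ * (w ^ 2) z) + (fun z => W.a₄ * (t * w ^ 2) z) +
        (fun z => W.a₆ * (w ^ 3) z) := by
    funext z
    simp only [Pi.add_apply, Pi.pow_apply]
  have h1 : AnalyticAt ℂ (t ^ 3) 0 := hta.pow 3
  have h2 : AnalyticAt ℂ (fun z => W.a₁ * (t * w) z) 0 := analyticAt_const.fun_mul (hta.mul hwa)
  have h3 : AnalyticAt ℂ (fun z => W.a₂ * (t ^ 2 * w) z) 0 :=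
    analyticAt_const.fun_mul ((hta.pow 2).mul hwa)
  have h4 : AnalyticAt ℂ (fun z => W.a₃ * (w ^ 2) z) 0 := analyticAt_const.fun_mul (hwa.pow 2)
  have h5 : AnalyticAt ℂ (fun z => W.a₄ * (t * w ^ 2) z) 0 :=
    analyticAt_const.fun_mul (hta.mul (hwa.pow 2))
  have h6 : AnalyticAt ℂ (fun z => W.a₆ * (w ^ 3) z) 0 := analyticAt_const.fun_mul (hwa.pow 3)
  have hF1 : 𝓣[w] = 𝓣[t] ^ 3 + C W.a₁ * 𝓣[t] * 𝓣[w] + C W.a₂ * 𝓣[t] ^ 2 * 𝓣[w] +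
      C W.a₃ * 𝓣[w] ^ 2 + C W.a₄ * 𝓣[t] * 𝓣[w] ^ 2 + C W.a₆ * 𝓣[w] ^ 3 := by
    have h := taylor_congr hE1
    rw [hfun1,
      taylor_add ((((h1.add h2).add h3).add h4).add h5) h6,
      taylor_add (((h1.add h2).add h3).add h4) h5, taylor_add ((h1.add h2).add h3) h4,
      taylor_add (h1.add h2) h3, taylor_add h1 h2, taylor_pow hta 3,
      taylor_const_mul, taylor_mul hta hwa, taylor_const_mul, taylor_mul (hta.pow 2) hwa,
      taylor_pow hta 2, taylor_const_mul, taylor_pow hwa 2, taylor_const_mul,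
      taylor_mul hta (hwa.pow 2), taylor_pow hwa 2, taylor_const_mul, taylor_pow hwa 3] at h
    refine h.trans ?_
    ring
  have hT0 : constantCoeff 𝓣[t] = 0 := by rw [constantCoeff_taylor, ht0]
  have hY0 : constantCoeff 𝓣[w] = 0 := by rw [constantCoeff_taylor, hw0]
  rw [hexp] at hF1 hT0
  exact W.fixedPoint_unique hT0 hY0 (PowerSeries.constantCoeff_subst_eq_zero hT0 _ W.constantCoeff_formalW) hF1
    (W.formalW_subst_eq_step hT0)

/-- **`x·t²` is analytic at `0` with value `1`, and equals `4(1 + z²(℘⁻ − b₂/12))³/Q²` near `0`** (`℘⁻ = ℘ − z⁻²`,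
`Q = 2 + a₁z + a₁z³(℘⁻ − b₂/12) + a₃z³ − z³℘⁻′`, the tree's normal form of `t = N/Q`). [Silverman AEC IV.1] [folklore] -/
theorem xMulLocalParamSq_eventuallyEq :
    (fun z => if z ∈ L.lattice then (1 : ℂ) else
        (℘[L] z - W.b₂ / 12) * (-(℘[L] z - W.b₂ / 12) /
          ((℘'[L] z - W.a₁ * (℘[L] z - W.b₂ / 12) - W.a₃) / 2)) ^ 2) =ᶠ[𝓝 0]
      fun z => 4 * (1 + z ^ 2 * (℘[L - (0 : ℂ)] z - W.b₂ / 12)) ^ 3 /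
        (2 + W.a₁ * z + W.a₁ * z ^ 3 * (℘[L - (0 : ℂ)] z - W.b₂ / 12) + W.a₃ * z ^ 3 -
          z ^ 3 * ℘'[L - (0 : ℂ)] z) ^ 2 := by
  obtain ⟨ht, -⟩ := localParam_eventuallyEq L W
  set E := ℘[L - (0 : ℂ)] with hE
  set E' := ℘'[L - (0 : ℂ)] with hE'
  set Q : ℂ → ℂ := fun z => 2 + W.a₁ * z + W.a₁ * z ^ 3 * (E z - W.b₂ / 12) + W.a₃ * z ^ 3 -
    z ^ 3 * E' z with hQ
  have hEa : AnalyticAt ℂ E 0 := L.analyticAt_weierstrassPExcept 0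
  have hE'a : AnalyticAt ℂ E' 0 := L.analyticAt_derivWeierstrassPExcept 0
  have hQa : AnalyticAt ℂ Q 0 := by rw [hQ]; fun_prop
  have hQ0 : Q 0 = 2 := by simp [hQ]
  have hQne : ∀ᶠ z in 𝓝 0, Q z ≠ 0 := hQa.continuousAt.eventually_ne (by rw [hQ0]; exact two_ne_zero)
  have hΛ := L.compl_lattice_sdiff_singleton_mem_nhds 0
  have hP : ∀ z, ℘[L] z = E z + 1 / z ^ 2 := L.weierstrassP_eq_weierstrassPExcept_add
  filter_upwards [ht, hQne, hΛ] with z htz hzQ hzΛ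
  by_cases hz : z = 0
  · subst hz
    simp only [zero_mem, if_true]
    change (1 : ℂ) = 4 * (1 + 0 ^ 2 * (E 0 - W.b₂ / 12)) ^ 3 / (Q 0) ^ 2
    rw [hQ0]; norm_num
  · have hzΛ' : z ∉ L.lattice := fun h => hzΛ ⟨h, hz⟩
    rw [if_neg hzΛ'] at htz ⊢
    change -(℘[L] z - W.b₂ / 12) / ((℘'[L] z - W.a₁ * (℘[L] z - W.b₂ / 12) - W.a₃) / 2) =
      (2 * z + 2 * z ^ 3 * (E z - W.b₂ / 12)) / Q z at htz
    change (℘[L] z - W.b₂ / 12) * (-(℘[L] z - W.b₂ / 12) /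
      ((℘'[L] z - W.a₁ * (℘[L] z - W.b₂ / 12) - W.a₃) / 2)) ^ 2 =
      4 * (1 + z ^ 2 * (E z - W.b₂ / 12)) ^ 3 / Q z ^ 2
    rw [htz, hP]
    field_simp
    ring

/-- `x·t²` (extended by `1` on `Λ`) is analytic at `0`. [folklore] -/
theorem analyticAt_xMulLocalParamSq :
    AnalyticAt ℂ (fun z => if z ∈ L.lattice then (1 : ℂ) else
        (℘[L] z - W.b₂ / 12) * (-(℘[L] z - W.b₂ / 12) /
          ((℘'[L] z - W.a₁ * (℘[L] z - W.b₂ / 12) - W.a₃) / 2)) ^ 2) 0 := by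
  have hEa : AnalyticAt ℂ ℘[L - (0 : ℂ)] 0 := L.analyticAt_weierstrassPExcept 0
  have hE'a : AnalyticAt ℂ ℘'[L - (0 : ℂ)] 0 := L.analyticAt_derivWeierstrassPExcept 0
  have hQa : AnalyticAt ℂ (fun z => 2 + W.a₁ * z + W.a₁ * z ^ 3 * (℘[L - (0 : ℂ)] z - W.b₂ / 12) +
      W.a₃ * z ^ 3 - z ^ 3 * ℘'[L - (0 : ℂ)] z) 0 := by fun_prop
  have hQ0 : (fun z => 2 + W.a₁ * z + W.a₁ * z ^ 3 * (℘[L - (0 : ℂ)] z - W.b₂ / 12) +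
      W.a₃ * z ^ 3 - z ^ 3 * ℘'[L - (0 : ℂ)] z) 0 ≠ 0 := by simp
  have hNa : AnalyticAt ℂ (fun z => 4 * (1 + z ^ 2 * (℘[L - (0 : ℂ)] z - W.b₂ / 12)) ^ 3) 0 := by
    fun_prop
  exact ((hNa.div (hQa.pow 2) (pow_ne_zero 2 hQ0))).congr (xMulLocalParamSq_eventuallyEq L W).symm

/-- **The Taylor series of `x·t²` along the uniformisation is `X ∘ exp_W`** (`X = formalXMulSq = z²x(z)`): the analytic
`x`-coordinate times the square of the analytic local parameter is the formal Laurent dictionary of AEC IV.1 read in the formal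
exponential.  [cite: SilvermanAEC2009, IV.1 and IV.1.1] [folklore] -/
theorem taylor_xMulLocalParamSq (h₂ : L.g₂ = W.c₄ / 12) (h₃ : L.g₃ = W.c₆ / 216) :
    𝓣[(fun z => if z ∈ L.lattice then (1 : ℂ) else
        (℘[L] z - W.b₂ / 12) * (-(℘[L] z - W.b₂ / 12) /
          ((℘'[L] z - W.a₁ * (℘[L] z - W.b₂ / 12) - W.a₃) / 2)) ^ 2)] =
      W.formalXMulSq.subst W.formalExp := by
  obtain ⟨hta, hwa⟩ := analyticAt_localParam L W
  have hexp := taylor_localParam_eq_formalExp L W h₂ h₃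
  have hW := taylor_localParamW_eq L W h₂ h₃
  have hy := eventually_y_ne_zero L W
  have hξa := analyticAt_xMulLocalParamSq L W
  set ξ : ℂ → ℂ := fun z => if z ∈ L.lattice then (1 : ℂ) else
        (℘[L] z - W.b₂ / 12) * (-(℘[L] z - W.b₂ / 12) /
          ((℘'[L] z - W.a₁ * (℘[L] z - W.b₂ / 12) - W.a₃) / 2)) ^ 2 with hξ
  set t : ℂ → ℂ := fun z => if z ∈ L.lattice then (0 : ℂ) else
    -(℘[L] z - W.b₂ / 12) / ((℘'[L] z - W.a₁ * (℘[L] z - W.b₂ / 12) - W.a₃) / 2) with ht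
  set w : ℂ → ℂ := fun z => if z ∈ L.lattice then (0 : ℂ) else
    -1 / ((℘'[L] z - W.a₁ * (℘[L] z - W.b₂ / 12) - W.a₃) / 2) with hw
  have hΛ := L.eventually_nhdsNE_notMem_lattice
  -- `ξ · 𝔴 = t³` near `0`
  have hprod : (ξ * w) =ᶠ[𝓝 0] (t ^ 3) := by
    refine eventually_nhds_of_nhdsNE ?_ ?_
    · filter_upwards [hΛ, hy] with z hzΛ hyz
      simp only [Pi.mul_apply, Pi.pow_apply, hξ, ht, hw, if_neg hzΛ]
      field_simp
    · simp [hξ, ht, hw, zero_mem]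
  have hTprod : 𝓣[ξ] * (W.formalW.subst W.formalExp) = W.formalExp ^ 3 := by
    rw [← hW, ← hexp, ← taylor_mul hξa hwa, taylor_congr hprod, taylor_pow hta 3]
  -- `X(exp) · w(exp) = exp³` formally
  have hE : HasSubst W.formalExp := HasSubst.of_constantCoeff_zero' W.constantCoeff_formalExp
  have hXprod : W.formalXMulSq.subst W.formalExp * W.formalW.subst W.formalExp = W.formalExp ^ 3 := by
    rw [← coe_substAlgHom hE, ← map_mul, formalXMulSq_mul_formalW, map_pow, substAlgHom_X]
  -- cancel `w(exp) ≠ 0` (its `z³`-coefficient is `1`)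
  have hne : W.formalW.subst W.formalExp ≠ 0 := by
    intro h0
    have hlow : ∀ m' < 3, coeff m' W.formalW = 0 := fun m' hm' => by
      rw [W.formalW_eq_X_pow_mul_formalWDivCube, coeff_X_pow_mul', if_neg (by omega)]
    have h3 := (coeff_subst_of_coeff_lt_eq_zero W.constantCoeff_formalExp
      (Summit.BirchSwinnertonDyer.BirchSwinnertonDyer.Theorems.DepletionAtTwo.ParamExpansion.coeff_one_formalExp W)
      hlow).2
    rw [h0, map_zero, W.formalW_eq_X_pow_mul_formalWDivCube, coeff_X_pow_mul', if_pos le_rfl, Nat.sub_self,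
      coeff_zero_eq_constantCoeff, W.constantCoeff_formalWDivCube] at h3
    exact zero_ne_one h3
  exact mul_right_cancel₀ hne (hTprod.trans hXprod.symm)

end Summit.BirchSwinnertonDyer.BirchSwinnertonDyer.Theorems.DepletionAtTwo.KummerQExp

end
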